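import Summits.AnomalousDissipation.AnomalousDissipation.Theses.TameRoughRigidity
import Summits.AnomalousDissipation.AnomalousDissipation.Theorems.TameClosure.Negative.LoadBearing
import Literature.Analysis.FluidPDE.StatisticalSolutionProofs
import Literature.Analysis.FluidPDE.StokesTorusProofs
import Literature.Analysis.FunctionSpaces.TorusFourierCalculus
import HarnessLib

/-!
# Disproof of `TameClosure` (crux K, stmt-AnomalousDissipation-18402) — findings

cdisprove seat `refuter-cdisprove-stmt-AnomalousDissipation-18402-0`, cycle 1 (2026-08-17).
K = TAME CLOSURE: `∀ E G₁`, [for every `r > 0` a Borel probability measure on `H = L²_σ(T³)` with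
integrable energy `≤ E`, mean enstrophy `≤ ofReal G₁` and Φ-uniform cylindrical forced-Euler defect
`|∫ L₀Φ dμ| ≤ r (∫ ‖∇Φ'‖² dμ)^{1/2}`] ⟹ [an exact FMRT stationary statistical solution of Euler forced
by `f_GP` with the same two bounds]. **VERDICT OF THIS CYCLE: NO KILL — K resists; it is very
probably TRUE** (a compactness theorem; the picked line `cutoff_compactness` is sound, all seven
active stubs re-derived by hand, see §0). Everything below is kernel-checked unless marked.

Findings (prose only here and in docstrings):

* §0 (docstring) WHY K RESISTS. `¬K ↔ ∃ (E,G₁), TameNearFamily E G₁ ∧ ¬ExactTameAt E G₁`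
  (`not_tameClosure_iff`). The second conjunct is the open rigidity problem N off the two horizons;
  ON the horizons (`E < 3/(4π)`: `tameClosure_conclusion_false_smallEnergy`, landed p143453;
  `G₁ < 3π`: `tameClosure_conclusion_false_smallEnstrophy`, NEW §2) the first conjunct fails too
  (`not_tameNearFamily_smallEnergy/_smallEnstrophy`, §3): a counterexample family MUST live at
  `E ≥ 3/(4π)` AND `G₁ ≥ 3π`, where no construction of Φ-uniformly near-stationary tame statistics of
  `f_GP` is known (time averages over finite windows are NOT Φ-uniformly near-stationary; Galerkin /
  perturbed-force / vanishing-viscosity families are either exact dodgers (= ¬N) or have unbounded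
  enstrophy). Given N, ANY tame near-family kills K (`not_tameClosure_of_nearFamily_of_coercive`), i.e.
  K ∧ N = "tame defect gap"; the census (j020739) finds spill ≥ 0.15 on every Galerkin dodger branch.
* §0 THE SEVEN STUBS of skeleton ae6bd9fe (stub_tightLimit, stub_cutoffTest, stub_cutoffFlux,
  stub_projectedStress, stub_cutoffAssembly, stub_limitExact, stub_symmetrise): hand-verified TRUE as
  stated, including the degenerate instances `K = 0` (P₀ = 0 on mean-zero `H`, `truncNormSq 0 v = 0`,
  Ψ = Φ needs `galerkinCutoff 0 = 1`), `G₁ ≤ 0` (class = {δ₀}), `E < 0` (empty class), `A < 0` in S3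
  (hypothesis unsatisfiable), `m = 0` tests (Φ' = 0), `a = b = 0` in (F1). The cross term
  `∫(P_K v ⊗ Q_K v):∇g` that worried the planner ("ρ ≫ K³") is handled in S2/(P1) by the class-uniform
  bound `C‖v‖‖Q_K v‖`, `∫ ≤ C√E√(G₁/(4π²(K²+1)))` — no rate competition between `ρ` and `K`.
* §1 ESCAPING ATOM (`limitExact_false_without_cutoff`, NEW): the "Reynolds stress at infinity" σ of the
  crux's why-might-fail IS REAL for a fixed quadratic observable even in the TAME class:
  `μₙ = (1−εₙ)δ₀ + εₙ δ_{tₙ u}` with `εₙ tₙ² = 1`, `u = sin(2πx₂)e₀ ∈ H`, has constant mean energy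
  `‖u‖²` and constant mean enstrophy `‖∇u‖²`, converges weakly to `δ₀`, and `F(v) = ‖u‖² − ‖v‖²`
  (continuous, `|F| ≤ A(1+‖v‖²)`) has `∫ F dμₙ = 0` for all `n` but `∫ F dδ₀ = ‖u‖² ≠ 0`. Hence the
  UN-CUT version of S3 (`stub_limitExact` with the cut-off scheme replaced by "∫ F dμₙ → 0", even with
  uniform tame bounds added) is FALSE: the cut-off `c` / auxiliary test `Ψ_{K,ρ}` of S2–S3 is
  load-bearing, and tameness (first moments of ‖v‖² and ‖∇v‖²) gives NO uniform integrability of the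
  quadratic generator. (What saves K: the escaping atom is visible to cylindrical tests whose fields see
  `u`, so `μₙ` is not a near-family; near-stationarity AT the cut-off test is what S2 exploits.)
* §2 ENSTROPHY HORIZON (`tameClosure_conclusion_false_smallEnstrophy`, NEW): no exact statistics of
  `f_GP` with mean enstrophy level `G₁ < 3π` (sharp Poincaré `4π²‖v‖² ≤ ‖∇v‖²` on `H` + the landed
  energy horizon `3/(4π)`), whatever `E`.
* §3 COUNTEREXAMPLE GEOGRAPHY (`not_tameNearFamily_smallEnergy`, `not_tameNearFamily_smallEnstrophy`):
  the hypothesis of K is unsatisfiable at `E < 3/(4π)` (any `G₁`) and at `G₁ < 3π` (any `E`).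
* §4 LOAD-BEARING HYPOTHESES (imported, landed p143453 by the crux-attack seat; NOT restated):
  probability normalisation (`tameClosure_false_without_prob`, zero measure) and the defect clause
  (`tameClosure_false_without_defect`, Dirac at rest); `Integrable ‖v‖²` is REDUNDANT given finite
  enstrophy (`GPStatisticalRigidity.Negative.integrable_norm_sq_of_ensembleEnstrophy_lt_top`). The
  TAMENESS clause `ensembleEnstrophy ≤ ofReal G₁` of the hypothesis: dropping it while keeping `G₁` in
  the conclusion is false as soon as `f_GP` carries ANY `L²` steady weak Euler state `U` (wild or tame:
  `δ_U` is then an exact near-family at every `G₁`, and `G₁ := 0` forces the conclusion onto `δ₀`) — not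
  provable here (no steady state of `f_GP` is constructible; a tame one is ¬N); dropping it from BOTH
  sides ("energy-bounded near-statistics close up") is open and morally false (σ-escape of ROUGH mass,
  cf. §1), which is why K carries the bound. Not attempted in Lean: recorded as the near-miss of §4.
* Natural strengthenings NOT refutable today: per-level modulus of closure; `energy < E` in the
  conclusion; evenness of the limit (true by symmetrisation); general smooth `f` (the stubs are already
  stated for every smooth `f`; closure is f-independent compactness).
-/

set_option linter.dupNamespace false

noncomputable section

namespace Summit.AnomalousDissipation.AnomalousDissipation.Cruxes.TameClosure.Disproof

open MeasureTheory Filter Topology UnitAddTorus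
open scoped InnerProductSpace RealInnerProductSpace ENNReal NNReal
open Literature.Analysis.FunctionSpaces Literature.Analysis.FluidPDE
open Summit.AnomalousDissipation.AnomalousDissipation.Theses.TameRoughRigidity
open Summit.AnomalousDissipation.AnomalousDissipation.Theorems.EnsembleRigidity
open Summit.AnomalousDissipation.AnomalousDissipation.Theorems.TameClosure.Negative

/-- Local notation: real vector fields on `T³`. -/
local notation "Vec3" => (UnitAddTorus (Fin 3)) → (EuclideanSpace ℝ (Fin 3))
/-- Local notation: `L²(T³; ℝ³)`. -/
local notation "L2" => (Lp (EuclideanSpace ℝ (Fin 3)) 2 (volume : Measure (UnitAddTorus (Fin 3))))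
/-- Local notation: the energy space `H`. -/
local notation "H3" => (Torus.energySpace (Fin 3))

/-! ## §0 The shape of a kill: near-family without exact statistics -/

/-- The HYPOTHESIS of K at level `(E, G₁)` (verbatim, force pinned as `gpForce`): tame near-statistics
of forced Euler for every defect radius `r > 0`. -/
def TameNearFamily (E G₁ : ℝ) : Prop :=
  ∀ r : ℝ, 0 < r → ∃ μ : Measure H3, IsProbabilityMeasure μ ∧
    Integrable (fun v : H3 => ‖v‖ ^ 2) μ ∧ Torus.ensembleEnergy μ ≤ E ∧
    Torus.ensembleEnstrophy μ ≤ ENNReal.ofReal G₁ ∧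
    (∀ Φ : Torus.CylindricalTest (Fin 3),
      Integrable (fun v : H3 => Torus.nsGeneratorPairing 0 gpForce v (Φ.grad v)) μ ∧
        |∫ v, Torus.nsGeneratorPairing 0 gpForce v (Φ.grad v) ∂μ| ≤
          r * Real.sqrt (∫ v, Torus.gradNormSq (Φ.grad v) ∂μ))

/-- The CONCLUSION of K at level `(E, G₁)` (verbatim, force pinned): an exact tame statistics. -/
def ExactTameAt (E G₁ : ℝ) : Prop :=
  ∃ μ : Measure H3, Torus.IsStationaryStatisticalSolution 0 gpForce μ ∧
    Integrable (fun v : H3 => ‖v‖ ^ 2) μ ∧ Torus.ensembleEnergy μ ≤ E ∧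
    Torus.ensembleEnstrophy μ ≤ ENNReal.ofReal G₁

/-- K, level by level, with the force substituted. -/
theorem tameClosure_iff : TameClosure ↔ ∀ E G₁ : ℝ, TameNearFamily E G₁ → ExactTameAt E G₁ := by
  constructor
  · intro h E G₁ hnear
    exact h gpForce rfl E G₁ hnear
  · intro h f hf E G₁ hnear
    subst hf
    exact h E G₁ hnear

/-- **The shape of a kill.** `¬K` is exactly: some level carries tame near-statistics for every
`r > 0` but no exact tame statistics. -/
theorem not_tameClosure_iff :
    ¬ TameClosure ↔ ∃ E G₁ : ℝ, TameNearFamily E G₁ ∧ ¬ ExactTameAt E G₁ := by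
  rw [tameClosure_iff]
  push Not
  rfl

/-- **Given N, any tame near-family kills K** (and with it X and the parent route): under
`GPEulerCoercive` there is no exact statistics at any level, so K is then equivalent to the TAME DEFECT
GAP "no level carries a near-family". A disprover of K must therefore CONSTRUCT Φ-uniformly
near-stationary tame statistics of `f_GP`; nothing less, and (modulo N) nothing more. -/
theorem not_tameClosure_of_nearFamily_of_coercive (hN : GPEulerCoercive) {E G₁ : ℝ}
    (h : TameNearFamily E G₁) : ¬ TameClosure := by
  rw [not_tameClosure_iff]
  exact ⟨E, G₁, h, fun ⟨μ, hμ, _⟩ => hN gpForce rfl μ hμ⟩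

/-! ## §1 The escaping atom: the un-cut limit lemma is false in the tame class -/

/-- `k₀ = (0, 0, 1) ≠ 0`. -/
private theorem k0_ne_zero : (Pi.single (2 : Fin 3) (1 : ℤ) : Fin 3 → ℤ) ≠ 0 := by
  intro h
  have := congrFun h 2
  simp at this

/-- `k₀ · e₀ = 0`. -/
private theorem k0_inner_e0 :
    ⟪Torus.latticeVec (Pi.single (2 : Fin 3) (1 : ℤ)), EuclideanSpace.single (0 : Fin 3) (1 : ℝ)⟫_ℝ = 0 := by
  simp [EuclideanSpace.inner_single_right, Torus.latticeVec_apply]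

/-- The escaping direction: the first Lamb piece `u = sin(2π x₂) e₀` of `f_GP`, an element of `H`. -/
def escapeMode : H3 :=
  ⟨Torus.stokesModeL2 (Pi.single (2 : Fin 3) (1 : ℤ)) (EuclideanSpace.single (0 : Fin 3) (1 : ℝ)) false,
    Torus.stokesModeL2_mem_energySpace k0_ne_zero k0_inner_e0 false⟩

/-- The escaping direction is a non-zero state of `H`. -/
theorem escapeMode_ne_zero : escapeMode ≠ 0 := by
  intro h
  have h' : (escapeMode : L2) = 0 := by rw [h]; rfl
  exact Torus.stokesModeL2_ne_zero k0_ne_zero (a := EuclideanSpace.single (0 : Fin 3) (1 : ℝ))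
    (by simp) false h'

/-- Its energy `‖u‖²` is positive. -/
theorem norm_sq_escapeMode_pos : 0 < ‖escapeMode‖ ^ 2 := by
  have : 0 < ‖escapeMode‖ := norm_pos_iff.2 escapeMode_ne_zero
  positivity

/-- The escaping direction has finite enstrophy (it is represented by a smooth field). -/
theorem eGradNormSq_escapeMode_lt_top :
    Torus.eGradNormSq (((escapeMode : H3) : L2) : Vec3) < ⊤ := by
  obtain ⟨g, hg, -, -, hae⟩ := Torus.stokesModeL2_mem_smoothSolenoidal (d := Fin 3) k0_ne_zero
    (a := EuclideanSpace.single (0 : Fin 3) (1 : ℝ)) k0_inner_e0 false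
  have : (((escapeMode : H3) : L2) : Vec3) =ᵐ[volume] g := hae
  rw [eGradNormSq_congr_ae this]
  exact Torus.eGradNormSq_lt_top hg

/-- Scaling of the spectral enstrophy, `‖∇(c • w)‖² = c²‖∇w‖²` (private copy of the folklore lemma of
`Theorems/MomentParityResolvedDissipationStubStressEnergyEq.lean` /
`Theorems/KolmogorovFloor/Negative/FarField.lean`, whose import would drag unrelated route cones into
this file). [folklore] -/
private theorem eGradNormSq_const_smul' (c : ℝ) (w : Vec3) :
    Torus.eGradNormSq (c • w) = ENNReal.ofReal (c ^ 2) * Torus.eGradNormSq w := by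
  have hcx : EuclideanSpace.complexify ∘ (c • w) = (c : ℂ) • (EuclideanSpace.complexify ∘ w) := by
    funext x
    ext i
    simp [EuclideanSpace.complexify_apply]
  rw [Torus.eGradNormSq_eq_tsum, Torus.eGradNormSq_eq_tsum]
  have hterm : ∀ k : Fin 3 → ℤ, ENNReal.ofReal (Torus.freqNormSq k) *
      ‖mFourierCoeff (EuclideanSpace.complexify ∘ (c • w)) k‖ₑ ^ 2 =
        ENNReal.ofReal (c ^ 2) * (ENNReal.ofReal (Torus.freqNormSq k) *
          ‖mFourierCoeff (EuclideanSpace.complexify ∘ w) k‖ₑ ^ 2) := by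
    intro k
    rw [hcx, Torus.mFourierCoeff_const_smul, enorm_smul, mul_pow]
    have h2 : ‖(c : ℂ)‖ₑ ^ 2 = ENNReal.ofReal (c ^ 2) := by
      rw [← ofReal_norm, Complex.norm_real, Real.norm_eq_abs, ← ENNReal.ofReal_pow (abs_nonneg c),
        sq_abs]
    rw [h2]
    ring
  simp_rw [hterm]
  rw [ENNReal.tsum_mul_left]
  ring

/-- Enstrophy of a scaled state of `H` (through the a.e. class of the representative). -/
theorem eGradNormSq_coe_smul (t : ℝ) (u : H3) :
    Torus.eGradNormSq ((((t • u : H3)) : L2) : Vec3) =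
      ENNReal.ofReal (t ^ 2) * Torus.eGradNormSq (((u : H3) : L2) : Vec3) := by
  rw [Submodule.coe_smul, eGradNormSq_congr_ae (Lp.coeFn_smul _ _)]
  exact eGradNormSq_const_smul' t _

/-- The state of rest has zero enstrophy (from the landed `ensembleEnstrophy_dirac_zero`). -/
theorem eGradNormSq_coe_zero : Torus.eGradNormSq ((((0 : H3)) : L2) : Vec3) = 0 := by
  have h := Summit.AnomalousDissipation.AnomalousDissipation.Theorems.GPStatisticalRigidity.Negative.ensembleEnstrophy_dirac_zero
  unfold Torus.ensembleEnstrophy at h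
  rwa [lintegral_dirac] at h

/-- The escape rate: `εₙ = (n+1)⁻²`, `tₙ = n+1`, so that `εₙ tₙ² = 1`. -/
def escEps (n : ℕ) : ℝ := (1 / ((n : ℝ) + 1)) ^ 2

/-- The escape scale `tₙ = n + 1`. -/
def escScale (n : ℕ) : ℝ := (n : ℝ) + 1

/-- `0 ≤ εₙ`. -/
theorem escEps_nonneg (n : ℕ) : 0 ≤ escEps n := by unfold escEps; positivity

/-- `εₙ ≤ 1`. -/
theorem escEps_le_one (n : ℕ) : escEps n ≤ 1 := by
  unfold escEps
  have h1 : 1 / ((n : ℝ) + 1) ≤ 1 := by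
    rw [div_le_one (by positivity)]
    linarith [(Nat.cast_nonneg n : (0 : ℝ) ≤ n)]
  have h0 : 0 ≤ 1 / ((n : ℝ) + 1) := by positivity
  nlinarith

/-- `0 ≤ tₙ`. -/
theorem escScale_nonneg (n : ℕ) : 0 ≤ escScale n := by unfold escScale; positivity

/-- The escape identity `εₙ tₙ² = 1`: the escaping atom carries constant energy. -/
theorem escEps_mul_escScale_sq (n : ℕ) : escEps n * escScale n ^ 2 = 1 := by
  unfold escEps escScale
  have : (n : ℝ) + 1 ≠ 0 := by positivity
  field_simp

/-- `εₙ → 0`: the escaping mass vanishes. -/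
theorem tendsto_escEps : Tendsto escEps atTop (𝓝 0) := by
  have h : Tendsto (fun n : ℕ => (1 / ((n : ℝ) + 1)) ^ 2) atTop (𝓝 ((0 : ℝ) ^ 2)) :=
    (tendsto_one_div_add_atTop_nhds_zero_nat (𝕜 := ℝ)).pow 2
  rw [zero_pow two_ne_zero] at h
  exact h

/-- **The escaping-atom sequence** `μₙ = (1 − εₙ) δ₀ + εₙ δ_{tₙ u}`: mass `εₙ → 0` escapes to infinity
along the fixed finite-enstrophy direction `u`, carrying constant energy `εₙ tₙ² ‖u‖² = ‖u‖²`. -/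
def escSeq (n : ℕ) : Measure H3 :=
  ENNReal.ofReal (1 - escEps n) • Measure.dirac (0 : H3) +
    ENNReal.ofReal (escEps n) • Measure.dirac (escScale n • escapeMode)

/-- Every observable is integrable against a Dirac mass. -/
theorem integrable_dirac_any (g : H3 → ℝ) (x : H3) : Integrable g (Measure.dirac x) :=
  (integrable_const (g x)).congr (ae_eq_dirac g).symm

/-- Every observable is integrable against the escaping-atom measures (two atoms). -/
theorem integrable_escSeq (g : H3 → ℝ) (n : ℕ) : Integrable g (escSeq n) :=
  ((integrable_dirac_any g 0).smul_measure ENNReal.ofReal_ne_top).add_measure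
    ((integrable_dirac_any g _).smul_measure ENNReal.ofReal_ne_top)

/-- Integrals against the escaping-atom measures. -/
theorem integral_escSeq (g : H3 → ℝ) (n : ℕ) :
    ∫ v, g v ∂(escSeq n) = (1 - escEps n) * g 0 + escEps n * g (escScale n • escapeMode) := by
  unfold escSeq
  rw [integral_add_measure ((integrable_dirac_any g 0).smul_measure ENNReal.ofReal_ne_top)
      ((integrable_dirac_any g _).smul_measure ENNReal.ofReal_ne_top),
    integral_smul_measure, integral_smul_measure, integral_dirac, integral_dirac,
    ENNReal.toReal_ofReal (sub_nonneg.2 (escEps_le_one n)), ENNReal.toReal_ofReal (escEps_nonneg n),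
    smul_eq_mul, smul_eq_mul]

/-- Lower integrals against the escaping-atom measures. -/
theorem lintegral_escSeq (g : H3 → ℝ≥0∞) (n : ℕ) :
    ∫⁻ v, g v ∂(escSeq n) =
      ENNReal.ofReal (1 - escEps n) * g 0 + ENNReal.ofReal (escEps n) * g (escScale n • escapeMode) := by
  unfold escSeq
  rw [lintegral_add_measure, lintegral_smul_measure, lintegral_smul_measure, lintegral_dirac,
    lintegral_dirac]
  simp only [smul_eq_mul]

/-- The escaping-atom measures are probability measures (`(1 − εₙ) + εₙ = 1`). -/
instance isProbabilityMeasure_escSeq (n : ℕ) : IsProbabilityMeasure (escSeq n) := by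
  refine ⟨?_⟩
  simp only [escSeq, Measure.add_apply, Measure.smul_apply, measure_univ, smul_eq_mul, mul_one]
  rw [← ENNReal.ofReal_add (sub_nonneg.2 (escEps_le_one n)) (escEps_nonneg n)]
  simp

/-- The escaping sequence converges to `δ₀` against every bounded (continuous or not) observable. -/
theorem tendsto_integral_escSeq (h : H3 → ℝ) {C : ℝ} (hC : ∀ v, |h v| ≤ C) :
    Tendsto (fun n => ∫ v, h v ∂(escSeq n)) atTop (𝓝 (∫ v, h v ∂(Measure.dirac (0 : H3)))) := by
  rw [integral_dirac]
  have hform : ∀ n, ∫ v, h v ∂(escSeq n) = h 0 + escEps n * (h (escScale n • escapeMode) - h 0) := by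
    intro n
    rw [integral_escSeq]
    ring
  simp_rw [hform]
  have hbound : ∀ n, |escEps n * (h (escScale n • escapeMode) - h 0)| ≤ escEps n * (2 * C) := by
    intro n
    rw [abs_mul, abs_of_nonneg (escEps_nonneg n)]
    refine mul_le_mul_of_nonneg_left ?_ (escEps_nonneg n)
    calc |h (escScale n • escapeMode) - h 0| ≤ |h (escScale n • escapeMode)| + |h 0| := abs_sub _ _
      _ ≤ C + C := add_le_add (hC _) (hC _)
      _ = 2 * C := by ring
  have hlim : Tendsto (fun n => escEps n * (h (escScale n • escapeMode) - h 0)) atTop (𝓝 0) := by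
    refine squeeze_zero_norm (a := fun n => escEps n * (2 * C)) (fun n => ?_) ?_
    · rw [Real.norm_eq_abs]
      exact hbound n
    · simpa using tendsto_escEps.mul_const (2 * C)
  simpa using tendsto_const_nhds.add hlim

/-- The escaping sequence is TAME: constant mean energy `‖u‖²`. -/
theorem ensembleEnergy_escSeq (n : ℕ) : Torus.ensembleEnergy (escSeq n) = ‖escapeMode‖ ^ 2 := by
  unfold Torus.ensembleEnergy
  rw [integral_escSeq, norm_zero, norm_smul, Real.norm_eq_abs, abs_of_nonneg (escScale_nonneg n)]
  have := escEps_mul_escScale_sq n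
  linear_combination (‖escapeMode‖ ^ 2) * this

/-- The escaping sequence is TAME: constant mean enstrophy `‖∇u‖²`. -/
theorem ensembleEnstrophy_escSeq (n : ℕ) :
    Torus.ensembleEnstrophy (escSeq n) = Torus.eGradNormSq (((escapeMode : H3) : L2) : Vec3) := by
  unfold Torus.ensembleEnstrophy
  rw [lintegral_escSeq, eGradNormSq_coe_zero, mul_zero, zero_add, eGradNormSq_coe_smul, ← mul_assoc,
    ← ENNReal.ofReal_mul (escEps_nonneg n), escEps_mul_escScale_sq, ENNReal.ofReal_one, one_mul]

/-- S3 (`stub_limitExact`) WITHOUT the cut-off scheme: weak convergence, a quadratic-growth continuous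
observable whose means along the sequence vanish identically, AND uniform tame bounds on the sequence
(integrable energy `≤ E`, mean enstrophy `≤ ofReal G`) — "then the limit mean vanishes". -/
def NaiveTameLimitExact : Prop :=
  ∀ (μ : ℕ → Measure H3) (μ' : Measure H3),
    (∀ n, IsProbabilityMeasure (μ n)) → IsProbabilityMeasure μ' →
    (∀ h : H3 → ℝ, Continuous h → (∃ C : ℝ, ∀ v, |h v| ≤ C) →
      Tendsto (fun n => ∫ v, h v ∂(μ n)) atTop (𝓝 (∫ v, h v ∂μ'))) →
    Integrable (fun v : H3 => ‖v‖ ^ 2) μ' →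
    (∀ n, Integrable (fun v : H3 => ‖v‖ ^ 2) (μ n)) →
    (∃ E : ℝ, ∀ n, Torus.ensembleEnergy (μ n) ≤ E) →
    (∃ G : ℝ, ∀ n, Torus.ensembleEnstrophy (μ n) ≤ ENNReal.ofReal G) →
    ∀ (F : H3 → ℝ), Continuous F → ∀ (A : ℝ), (∀ v, |F v| ≤ A * (1 + ‖v‖ ^ 2)) →
      (∀ n, Integrable F (μ n)) → (∀ n, ∫ v, F v ∂(μ n) = 0) →
      ∫ v, F v ∂μ' = 0

/-- **The un-cut limit lemma is FALSE, even in the tame class** (escaping atom). Any proof of K must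
test the approximants against CUT-OFF functionals (S2's `Ψ_{K,ρ}` / S3's `c`): weak convergence plus
uniform bounds on the FIRST moments of `‖v‖²` and `‖∇v‖²` do not pass a quadratic observable to the
limit — the σ of the crux's why-might-fail, realised. -/
theorem limitExact_false_without_cutoff : ¬ NaiveTameLimitExact := by
  intro h
  set u : H3 := escapeMode with hu
  set F : H3 → ℝ := fun v => ‖u‖ ^ 2 - ‖v‖ ^ 2 with hF
  have key := h escSeq (Measure.dirac 0) (fun n => inferInstance) inferInstance
    (fun g _ ⟨C, hC⟩ => tendsto_integral_escSeq g hC) (integrable_dirac_any _ _)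
    (fun n => integrable_escSeq _ n) ⟨‖u‖ ^ 2, fun n => (ensembleEnergy_escSeq n).le⟩
    ⟨(Torus.eGradNormSq (((escapeMode : H3) : L2) : Vec3)).toReal, fun n => by
      rw [ensembleEnstrophy_escSeq, ENNReal.ofReal_toReal eGradNormSq_escapeMode_lt_top.ne]⟩
    F (continuous_const.sub (continuous_norm.pow 2)) (1 + ‖u‖ ^ 2) (fun v => by
      have h1 : |F v| ≤ ‖u‖ ^ 2 + ‖v‖ ^ 2 := by
        rw [hF]
        refine (abs_sub _ _).trans ?_
        rw [abs_of_nonneg (by positivity), abs_of_nonneg (by positivity)]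
      nlinarith [sq_nonneg ‖u‖, sq_nonneg ‖v‖, mul_nonneg (sq_nonneg ‖u‖) (sq_nonneg ‖v‖)])
    (fun n => integrable_escSeq _ n) (fun n => by
      rw [hF, integral_escSeq, norm_zero, norm_smul, Real.norm_eq_abs, abs_of_nonneg (escScale_nonneg n)]
      have := escEps_mul_escScale_sq n
      linear_combination (-(‖u‖ ^ 2)) * this)
  rw [integral_dirac, hF] at key
  simp only [norm_zero] at key
  have := norm_sq_escapeMode_pos
  rw [← hu] at this
  nlinarith

/-- The same without the tame bounds (a fortiori). -/
theorem limitExact_false_without_cutoff' :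
    ¬ ∀ (μ : ℕ → Measure H3) (μ' : Measure H3),
      (∀ n, IsProbabilityMeasure (μ n)) → IsProbabilityMeasure μ' →
      (∀ h : H3 → ℝ, Continuous h → (∃ C : ℝ, ∀ v, |h v| ≤ C) →
        Tendsto (fun n => ∫ v, h v ∂(μ n)) atTop (𝓝 (∫ v, h v ∂μ'))) →
      Integrable (fun v : H3 => ‖v‖ ^ 2) μ' →
      ∀ (F : H3 → ℝ), Continuous F → ∀ (A : ℝ), (∀ v, |F v| ≤ A * (1 + ‖v‖ ^ 2)) →
        (∀ n, Integrable F (μ n)) → (∀ n, ∫ v, F v ∂(μ n) = 0) →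
        ∫ v, F v ∂μ' = 0 :=
  fun h => limitExact_false_without_cutoff fun μ μ' h1 h2 h3 h4 _ _ _ F hF A hA h5 h6 =>
    h μ μ' h1 h2 h3 h4 F hF A hA h5 h6

/-! ## §2 The enstrophy horizon of the conclusion -/

/-- **Sharp Poincaré on `H`** in `ℝ≥0∞`: `4π² ‖v‖² ≤ ‖∇v‖₂²` (zero mode vanishes, `|k|² ≥ 1`
elsewhere; the tree's `Torus.enorm_sq_le_eGradNormSq` discards the factor `4π²`). [folklore] -/
theorem ofReal_mul_enorm_sq_le_eGradNormSq (u : H3) :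
    ENNReal.ofReal (4 * Real.pi ^ 2) * ‖u‖ₑ ^ 2 ≤ Torus.eGradNormSq (((u : H3) : L2) : Vec3) := by
  have h0 := Torus.mFourierCoeff_complexify_coe_zero_of_mem u.2
  have hn : ‖u‖ₑ = ‖((u : H3) : L2)‖ₑ := rfl
  rw [hn, Torus.enorm_sq_coe_eq_tsum, Torus.eGradNormSq_eq_tsum]
  refine mul_le_mul' le_rfl (ENNReal.tsum_le_tsum fun k => ?_)
  by_cases hk : k = 0
  · subst hk
    simp [h0]
  · exact le_mul_of_one_le_left zero_le (ENNReal.one_le_ofReal.2 (Torus.one_le_freqNormSq hk))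

/-- **Mean energy is controlled by mean enstrophy**: `4π² ∫‖v‖² dμ ≤ max G₁ 0` whenever
`∫⁻ ‖∇v‖² dμ ≤ ofReal G₁` and the energy is integrable. -/
theorem ensembleEnergy_le_of_ensembleEnstrophy_le (μ : Measure H3)
    (hint : Integrable (fun v : H3 => ‖v‖ ^ 2) μ) {G₁ : ℝ}
    (hG : Torus.ensembleEnstrophy μ ≤ ENNReal.ofReal G₁) :
    4 * Real.pi ^ 2 * Torus.ensembleEnergy μ ≤ max G₁ 0 := by
  have hE0 : 0 ≤ Torus.ensembleEnergy μ := integral_nonneg fun v => by positivity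
  -- integrate the pointwise Poincaré inequality
  have h1 : ENNReal.ofReal (4 * Real.pi ^ 2) * ∫⁻ v, ‖v‖ₑ ^ 2 ∂μ ≤ Torus.ensembleEnstrophy μ := by
    rw [← lintegral_const_mul' _ _ ENNReal.ofReal_ne_top]
    exact lintegral_mono fun v => ofReal_mul_enorm_sq_le_eGradNormSq v
  have h2 : ∫⁻ v, ‖v‖ₑ ^ 2 ∂μ = ENNReal.ofReal (Torus.ensembleEnergy μ) := by
    unfold Torus.ensembleEnergy
    rw [ofReal_integral_eq_lintegral_ofReal hint (ae_of_all _ fun v => by positivity)]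
    refine lintegral_congr fun v => ?_
    rw [← ofReal_norm, ENNReal.ofReal_pow (norm_nonneg _)]
  rw [h2, ← ENNReal.ofReal_mul (by positivity)] at h1
  have h3 := ENNReal.toReal_mono ENNReal.ofReal_ne_top (h1.trans hG)
  rwa [ENNReal.toReal_ofReal (by positivity), ENNReal.toReal_ofReal'] at h3

/-- **No exact statistics of `f_GP` below the enstrophy horizon `3π`**: the conclusion of K is false
at every level `G₁ < 3π`, whatever `E` (sharp Poincaré + the landed energy horizon `3/(4π)`). -/
theorem tameClosure_conclusion_false_smallEnstrophy (E G₁ : ℝ) (hG : G₁ < 3 * Real.pi) :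
    ¬ ExactTameAt E G₁ := by
  rintro ⟨μ, hμ, hint, -, hGμ⟩
  have hpi : 0 < Real.pi := Real.pi_pos
  have key := ensembleEnergy_le_of_ensembleEnstrophy_le μ hint hGμ
  have hmax : max G₁ 0 < 3 * Real.pi := max_lt hG (by positivity)
  have hE' : Torus.ensembleEnergy μ < 3 / (4 * Real.pi) := by
    rw [lt_div_iff₀ (by positivity)]
    nlinarith
  exact tameClosure_conclusion_false_smallEnergy _ hE' ⟨μ, hμ, hint, le_rfl⟩

/-! ## §3 Counterexample geography: where a near-family cannot live -/

/-- **No tame near-family below the energy horizon** (the contrapositive form of the crux-attack seat's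
`tameClosure_smallEnergy`, XtoK.lean): at `E < 3/(4π)` the hypothesis of K is unsatisfiable, by the
landed second-moment rigidity block `gpRigid_smallEnergy`. -/
theorem not_tameNearFamily_smallEnergy {E : ℝ} (hE : E < 3 / (4 * Real.pi)) (G₁ : ℝ) :
    ¬ TameNearFamily E G₁ := by
  intro h
  obtain ⟨c, δ₀, hc, hδ₀, hrig⟩ := GPStatisticalRigidity.gpRigid_smallEnergy gpForce rfl E hE
  -- a defect radius below δ₀ and below c / √(max G₁ 0 + 1)
  set s : ℝ := Real.sqrt (max G₁ 0) + 1 with hs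
  have hs0 : 0 < s := by positivity
  set r : ℝ := min δ₀ (c / (2 * s)) with hr
  have hr0 : 0 < r := lt_min hδ₀ (by positivity)
  obtain ⟨μ, hprob, hint, hEμ, hGμ, hdef⟩ := h r hr0
  have hGtop : Torus.ensembleEnstrophy μ < ⊤ := hGμ.trans_lt ENNReal.ofReal_lt_top
  have key := hrig μ hprob hint hEμ hGtop r hr0.le (min_le_left _ _) hdef
  -- but r √G ≤ (c/(2s)) · √(max G₁ 0) < c
  have hsqrt : Real.sqrt (Torus.ensembleEnstrophy μ).toReal ≤ Real.sqrt (max G₁ 0) := by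
    refine Real.sqrt_le_sqrt ?_
    have := ENNReal.toReal_mono ENNReal.ofReal_ne_top hGμ
    rwa [ENNReal.toReal_ofReal'] at this
  have h1 : r * Real.sqrt (Torus.ensembleEnstrophy μ).toReal ≤ (c / (2 * s)) * s :=
    mul_le_mul (min_le_right _ _) (hsqrt.trans (by linarith)) (Real.sqrt_nonneg _) (by positivity)
  have h2 : (c / (2 * s)) * s = c / 2 := by
    field_simp
  linarith

/-- **No tame near-family below the enstrophy horizon**: at `G₁ < 3π` the hypothesis of K is
unsatisfiable, whatever `E` (each approximant has energy `≤ max G₁ 0 / (4π²) < 3/(4π)`). -/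
theorem not_tameNearFamily_smallEnstrophy (E : ℝ) {G₁ : ℝ} (hG : G₁ < 3 * Real.pi) :
    ¬ TameNearFamily E G₁ := by
  intro h
  have hpi : 0 < Real.pi := Real.pi_pos
  have hmax : max G₁ 0 < 3 * Real.pi := max_lt hG (by positivity)
  set E' : ℝ := max G₁ 0 / (4 * Real.pi ^ 2) with hE'
  have hE'lt : E' < 3 / (4 * Real.pi) := by
    rw [hE', div_lt_div_iff₀ (by positivity) (by positivity)]
    nlinarith
  refine not_tameNearFamily_smallEnergy hE'lt G₁ fun r hr => ?_
  obtain ⟨μ, hprob, hint, -, hGμ, hdef⟩ := h r hr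
  refine ⟨μ, hprob, hint, ?_, hGμ, hdef⟩
  have key := ensembleEnergy_le_of_ensembleEnstrophy_le μ hint hGμ
  rw [hE', le_div_iff₀ (by positivity)]
  linarith

/-- Hence K HOLDS (vacuously) off the quadrant `E ≥ 3/(4π) ∧ G₁ ≥ 3π`; a counterexample lives inside it. -/
theorem counterexample_geography {E G₁ : ℝ} (h : TameNearFamily E G₁ ∧ ¬ ExactTameAt E G₁) :
    3 / (4 * Real.pi) ≤ E ∧ 3 * Real.pi ≤ G₁ := by
  obtain ⟨hnear, -⟩ := h
  refine ⟨not_lt.1 fun hE => not_tameNearFamily_smallEnergy hE G₁ hnear,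
    not_lt.1 fun hG => not_tameNearFamily_smallEnstrophy E hG hnear⟩

end Summit.AnomalousDissipation.AnomalousDissipation.Cruxes.TameClosure.Disproof

end
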